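import Summits.BirchSwinnertonDyer.Rank1Residual.Additive.GordDescentFreeFieldX3
import Summits.BirchSwinnertonDyer.Rank1Residual.Additive.GordDescentModelFreeThree
import HarnessLib

/-!
# X3♯(G-ord) / X4♯(G-ord), defect 2, `p = 3` (and any odd `p` with a twist datum): the free descent field — twist-rank and X1 data removed

HONEST FRAMING (cell `b2b-bsdres`, run/shared/lean/b2b/bsd-rank1-residual/, verbatim in every
file): the goal of the cell is to DELETE the COMBINATION-SHAPED residual classes of the
Birch–Swinnerton-Dyer formula for ALL analytic-rank `≤ 1` elliptic curves over `ℚ` — "full BSD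
formula for every rank `≤ 1` curve in class `C`" assembled STRICTLY from published theorems — so
that the rank-`≤ 1` remainder becomes exactly the CONSTRUCTION-SHAPED classes, which are TYPED
(missing-input `Prop`s), NOT attempted. This is not "finishing BSD". Sub-cell `additive-p2`
(CLASS-OWNERS row "X3/X4 additive — pot. good ordinary / X3♯(G-ord)"), generation 6: research
route; no claim beyond the stated classes; theorems only, no definition, no new named fact;
X3♯(G-ord)/X4♯(G-ord) stay CONSTRUCTION-SHAPED.

WHAT THIS FILE DOES. `GordDescentFreeField.lean` / `GordDescentFreeFieldX3.lean` freed the descent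
field at `p ≥ 5`, where the good ordinary twist `E^{(p*)}` is PRODUCED from the class (gen 4). At
`p = 3` (wild) the class theorems of `GordDescentModelFreeThree.lean` keep the twist-good datum
("every globally minimal model of `E^{(−3)}` is good at `3`"; census: all 421 sub-class pairs at
`p = 3` are `I₀*` with `E^{(−3)}` good ordinary at `3`). This file runs the twist supply FROM THAT
DATUM, at any odd `p`:

* `exists_goodOrd_rankZero_nonAnom_twist_of_goodOrd_model` — odd `p`, a globally minimal
  `W₁ ≅ E^{(d₀)}` good ordinary at `p` (Hoffstein–Luo 1997 `hHL`): there are a square-free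
  `d' ≡ 1 (mod 8)`, `p ∤ d'`, and a globally minimal `Wd ≅ E^{(d₀ d')}` good ORDINARY at `p`, of
  analytic rank `0`, NOT anomalous (`a_p ≢ 1 (mod p)`) — the proof of
  `exists_goodOrd_rankZero_nonAnom_twist_of_typeGOrd` from the datum (auxiliary prime
  `u ≡ 1 (mod 8)` with `(p/u) = −1` when `a_p(W₁) ≡ 1`);
* **`bsdp_three_of_classX3_of_forall_ramified`** — `(E,3) ∈ X3`, `r_an(E) ≤ 1`, twist-good datum:
  **`BSD(E,3)` follows from `MissingPPartOverCAt (W.baseChange K) 3` granted for every quadratic `K`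
  with `3 ∣ d_K`** (+ published binders: Castella–Grossi–Skinner 2025 Thm. D chain = row C6, GZK,
  modularity, Milne 1972 any-model, Hoffstein–Luo 1997; ordinarity of `E^{(−3)}` by Serre Prop. 12,
  `goodOrd_twist_of_red`). Versus gen 4's `bsdp_three_of_classX3_cases`: the twist-rank hypothesis
  `r_an(E^{(−3)}) ≤ 1` AND the typed X1 input of the twist pair are GONE (census
  `TWIST-CENSUS.md`: at `p = 3` the twist pair of 221 ‖ 131 of the 270 ‖ 157 X3♯(G-ord) pairs is an
  X1 pair; at `p ≥ 5`, 22 ‖ 16 of 31 ‖ 18 — handled by `bsdp_of_classX3Gord_two_of_forall_ramified`;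
  and for ONE pair, 16758y1 at `p = 3`, the twist `E^{(−3)}` = 1862a1 has analytic rank `2`, so the
  gen-4 theorem is void there while this one applies);
* **`bsdp_three_of_classX4Gord_of_surj_of_forall_ramified`** — `(E,3) ∈ X4♯(G-ord)`, `ρ̄_{E,3}`
  onto, `r_an(E) ≤ 1`, twist-good datum: `BSD(E,3)` from the over-`K` input over the quadratic `K`
  with `3 ∣ d_K` (row C16 for the supplied twist: Yan–Zhu 2026 Thm. 4.15, `RowC16.bsdp`; ordinarity
  of `E^{(−3)}` from `TypeGOrd`, gen 4's `goodOrd_of_typeGOrd_of_hasGoodReductionAtPrime`) — gen 4's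
  `bsdp_three_of_classX4Gord_of_surj` without `hrd` (census: 143 ‖ 25 C16-twist pairs).

NET for the defect-2 cell of X3♯(G-ord)/X4♯(G-ord) (681 pairs at N < 2·10⁴, all 421 at `p = 3`
included): X3 entirely and X4 on its surjective-image rows are reduced to ONE uniform typed
statement — "the `p`-part of BSD for `E` over the quadratic fields ramified at `p`", `E_K` being
GOOD ORDINARY at the ramified prime (`GordDescentField.lean`) — plus, at `p = 3` only, the
twist-good datum. Printed nowhere (Wan 2015 §1.1 / BCS 2025 §2.1 (ur); BDP / JSW `p` split;
W. Zhang 2014 `p ∤ D_K N`); labels, census, located gap UNCHANGED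
(HOME/b2b-bsdres-additive-p2/AUDIT-X34-GORD.md). The X4 rows WITHOUT surjective `ρ̄` (CM twists
C8/C10; X9/X10 twist inputs: 3 + 8 census pairs) keep gen 4's `bsdp_of_classX4Gord_two_cases`.

References: J. Hoffstein, W. Luo, Math. Res. Lett. 4 (1997) 435–442, Theorem; F. Castella,
G. Grossi, C. Skinner (2025), Thm. D; X. Yan, X. Zhu (2026), Thm. 4.15; C. Wuthrich, *On the
integrality of modular symbols and Kato's Euler system*, Doc. Math. 19 (2014), Lemma 20;
J.-P. Serre, Invent. Math. 15 (1972) §1.11 Prop. 12; A. W. Knapp, *Elliptic Curves*, Prop. 12.10;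
J. S. Milne, Invent. Math. 17 (1972); D. Delbourgo, Compositio Math. 113 (1998) §1.5.
-/

noncomputable section

open scoped Classical NumberField

open WeierstrassCurve IsDedekindDomain NumberField Literature.NumberTheory.EllipticCurves
  Literature.NumberTheory.EllipticCurves.Rank1Residual
  Literature.NumberTheory.EllipticCurves.Rank1Residual.Typed
  Literature.NumberTheory.EllipticCurves.ModularForms
  Literature.NumberTheory.EllipticCurves.Wuthrich2014
  Summit.BirchSwinnertonDyer.Rank1Residual.AdditivePotMult

namespace Summit.BirchSwinnertonDyer.Rank1Residual.Additive

variable (W : WeierstrassCurve ℚ) [W.IsElliptic] [W.IsGloballyMinimal] (p : ℕ) [hp : Fact p.Prime]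

/-! ### Supply from a good ordinary twist DATUM at any odd `p` -/

section Supply

omit [W.IsElliptic] [W.IsGloballyMinimal] in
/-- **From ONE good ordinary twist to a good ordinary, rank-zero, NON-ANOMALOUS twist ramified the
same way at `p`** (any odd prime `p`; Hoffstein–Luo 1997 `hHL`). Given a globally minimal
`W₁ ≅ E^{(d₀)}` good ordinary at `p`, there are a square-free `d' ≡ 1 (mod 8)` with `p ∤ d'` and a
globally minimal `Wd ≅ E^{(d₀ d')}` good ORDINARY at `p`, of analytic rank `0`, with
`a_p(Wd) ≢ 1 (mod p)`. The proof of `exists_goodOrd_rankZero_nonAnom_twist_of_typeGOrd`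
(`GordDescentFreeFieldX3.lean`, where `d₀ = p*` and `W₁` comes from the class at `p ≥ 5`) run from
the datum: Hoffstein–Luo with `S = {p}` if `a_p(W₁) ≢ 1`, else an auxiliary prime `u ≡ 1 (mod 8)`
with `(p/u) = −1` first (`(u/p) = −1` flips the sign of `a_p`), then Hoffstein–Luo with `S = {p, u}`.
[cite: HoffsteinLuo1997, Theorem (§1, pp. 435–436)] [cite: Knapp1993, Prop. 12.10] -/
theorem exists_goodOrd_rankZero_nonAnom_twist_of_goodOrd_model
    (hHL : HoffsteinLuo1997_exists_twist_L_one_ne_zero) (hp2 : p ≠ 2) {d₀ : ℚ}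
    (W₁ : WeierstrassCurve ℚ) [W₁.IsElliptic] [W₁.IsGloballyMinimal]
    (hW₁ : ∃ C : VariableChange ℚ, C • W.quadraticTwist d₀ = W₁) (hord₁ : GoodOrd W₁ p) :
    ∃ (d' : ℤ) (Wd : WeierstrassCurve ℚ) (_ : Wd.IsElliptic) (_ : Wd.IsGloballyMinimal),
      Squarefree d' ∧ d' % 8 = 1 ∧ ¬ (p : ℤ) ∣ d' ∧
      (∃ C : VariableChange ℚ, C • W.quadraticTwist (d₀ * d') = Wd) ∧
      GoodOrd Wd p ∧ Wd.analyticRank = 0 ∧ ¬ (p : ℤ) ∣ Wd.frobeniusTrace p - 1 := by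
  have hp1 : 1 < p := hp.out.one_lt
  by_cases han : (p : ℤ) ∣ W₁.frobeniusTrace p - 1
  · -- anomalous datum: flip the sign of `a_p` with an auxiliary prime `u`, `(u/p) = −1`
    obtain ⟨u, hBu, hu, hu8, hJu⟩ := exists_prime_one_mod_eight_jacobiSym_eq {p}
      (fun ℓ hℓ => by rw [Finset.mem_singleton.mp hℓ]; exact ⟨hp.out, hp2⟩) (fun _ => -1)
      (fun _ _ => Or.inr rfl) p
    have hJpu : jacobiSym (p : ℤ) u = -1 := hJu p (Finset.mem_singleton_self p)
    have hup : u ≠ p := by omega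
    have hu2 : u ≠ 2 := by omega
    have husq : Squarefree (u : ℤ) := Int.squarefree_natCast.mpr hu.squarefree
    have hpu : ¬ (p : ℤ) ∣ (u : ℤ) := fun h =>
      hup ((Nat.prime_dvd_prime_iff_eq hp.out hu).mp (Int.natCast_dvd_natCast.mp h)).symm
    have hlu : legendreSym p u = -1 := by
      have hpodd : Odd p := hp.out.odd_of_ne_two hp2
      rw [jacobiSym.legendreSym.to_jacobiSym,
        jacobiSym.quadratic_reciprocity_one_mod_four (by omega) hpodd, hJpu]
    obtain ⟨W₂, iW₂, iW₂m, hC₂, hord₂, htr₂⟩ :=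
      exists_twist_goodOrd_frobeniusTrace p W₁ hp2 hord₁ husq hpu
    obtain ⟨d'', hsq, hd8, -, hjac, hL⟩ := hHL.exists W₂ {p, u}
    have hj1 : jacobiSym d'' p = 1 := hjac p (Finset.mem_insert_self p {u}) hp.out hp2
    have hju : jacobiSym d'' u = 1 :=
      hjac u (Finset.mem_insert_of_mem (Finset.mem_singleton_self u)) hu hu2
    have hpd : ¬ (p : ℤ) ∣ d'' := by
      intro hdvd
      rw [jacobiSym.mod_left, Int.emod_eq_zero_of_dvd hdvd, jacobiSym.zero_left hp1] at hj1
      exact zero_ne_one hj1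
    have hud : ¬ (u : ℤ) ∣ d'' := by
      intro hdvd
      rw [jacobiSym.mod_left, Int.emod_eq_zero_of_dvd hdvd, jacobiSym.zero_left hu.one_lt] at hju
      exact zero_ne_one hju
    have hld : legendreSym p d'' = 1 := by rw [jacobiSym.legendreSym.to_jacobiSym, hj1]
    obtain ⟨Wd, iWd, iWdm, hC₃, hord₃, htr₃⟩ :=
      exists_twist_goodOrd_frobeniusTrace p W₂ hp2 hord₂ hsq hpd
    have hd0 : ((d'' : ℤ) : ℚ) ≠ 0 := by exact_mod_cast hsq.ne_zero
    haveI := W₂.isElliptic_quadraticTwist hd0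
    refine ⟨u * d'', Wd, iWd, iWdm, ?_, ?_, ?_, ?_, hord₃, ?_, ?_⟩
    · rw [← Int.squarefree_natAbs, Int.natAbs_mul, Int.natAbs_natCast, Nat.squarefree_mul_iff]
      exact ⟨(Nat.Prime.coprime_iff_not_dvd hu).mpr (fun h => hud (Int.natCast_dvd.mpr h)),
        hu.squarefree, Int.squarefree_natAbs.mpr hsq⟩
    · have hu8Z : (u : ℤ) % 8 = 1 := by exact_mod_cast hu8
      rw [Int.mul_emod, hu8Z, hd8]; norm_num
    · intro h
      rcases (Nat.prime_iff_prime_int.mp hp.out).dvd_or_dvd h with h1 | h1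
      · exact hpu h1
      · exact hpd h1
    · have h := exists_model_twist_mul W (exists_model_twist_mul W hW₁ hC₂) hC₃
      push_cast
      rw [← mul_assoc]
      exact h
    · obtain ⟨C₃, hC₃'⟩ := hC₃
      rw [← hC₃', analyticRank_smul]
      exact Literature.NumberTheory.EllipticCurves.analyticRank_eq_zero_of_entireLFunction_one_ne_zero
        _ hL
    · rw [htr₃, htr₂, hld, hlu, one_mul]
      intro h
      have h2 : (p : ℤ) ∣ 2 := by
        have h' : (p : ℤ) ∣ (W₁.frobeniusTrace p - 1) + (-1 * W₁.frobeniusTrace p - 1) :=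
          dvd_add han h
        have hs : (W₁.frobeniusTrace p - 1) + (-1 * W₁.frobeniusTrace p - 1) = -2 := by ring
        rw [hs] at h'
        exact dvd_neg.mp h'
      have hle := Int.le_of_dvd two_pos h2
      have hp3 : 3 ≤ p := by
        rcases hp.out.eq_two_or_odd with h | h
        · exact absurd h hp2
        · have := hp.out.two_le; omega
      omega
  · obtain ⟨d', hsq, hd8, -, hjac, hL⟩ := hHL.exists W₁ {p}
    have hj1 : jacobiSym d' p = 1 := hjac p (Finset.mem_singleton_self p) hp.out hp2
    have hpd : ¬ (p : ℤ) ∣ d' := by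
      intro hdvd
      rw [jacobiSym.mod_left, Int.emod_eq_zero_of_dvd hdvd, jacobiSym.zero_left hp1] at hj1
      exact zero_ne_one hj1
    have hld : legendreSym p d' = 1 := by rw [jacobiSym.legendreSym.to_jacobiSym, hj1]
    obtain ⟨Wd, iWd, iWdm, hC₂, hord₂, htr₂⟩ :=
      exists_twist_goodOrd_frobeniusTrace p W₁ hp2 hord₁ hsq hpd
    have hd0 : ((d' : ℤ) : ℚ) ≠ 0 := by exact_mod_cast hsq.ne_zero
    haveI := W₁.isElliptic_quadraticTwist hd0
    refine ⟨d', Wd, iWd, iWdm, hsq, hd8, hpd, exists_model_twist_mul W hW₁ hC₂, hord₂, ?_, ?_⟩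
    · obtain ⟨C₂, hC₂'⟩ := hC₂
      rw [← hC₂', analyticRank_smul]
      exact Literature.NumberTheory.EllipticCurves.analyticRank_eq_zero_of_entireLFunction_one_ne_zero
        _ hL
    · rw [htr₂, hld, one_mul]
      exact han

end Supply

/-! ### `p = 3`: X3♯(G-ord) and X4♯(G-ord) (surjective `ρ̄`) with a free descent field -/

section Three

/-- **X3♯(G-ord) ∩ `I₀*` at `p = 3`, `r_an(E) ≤ 1`: `BSD(E,3)` from the over-`K` input over the
quadratic fields RAMIFIED at `3` — with NO X1 input and NO twist-rank datum.** Hypotheses as in gen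
4's `bsdp_three_of_classX3_cases`: the model-free twist-good datum `hgood` ("every globally minimal
model of `E^{(−3)}` is good at `3`" — `3` is wild; the census certifies it on all 421 sub-class pairs
at `p = 3`), and now ONLY the over-`K` input over the quadratic `K` with `3 ∣ d_K`
(`MissingPPartOverCAt (W.baseChange K) 3`); the inputs `hrd` (`r_an(E^{(−3)}) ≤ 1`) and `hX1` (the
typed X1 input of the twist pair, 221 ‖ 131 of the 270 ‖ 157 X3 `p = 3` census pairs) of the gen-4
theorem are GONE. The twist `E^{(−3)}` is good ORDINARY (Serre Prop. 12, `goodOrd_twist_of_red`);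
the supply `exists_goodOrd_rankZero_nonAnom_twist_of_goodOrd_model` gives a non-anomalous rank-0
good ordinary `E^{(−3d')}`, `3 ∤ d'`, which is row C6 (Castella–Grossi–Skinner 2025 Thm. D chain,
`RowC6.bsdp`); descent over `ℚ(√(−3d'))`. [cite: HoffsteinLuo1997, Theorem (§1, pp. 435–436)]
[cite: CastellaGrossiSkinner2025, Thm. D (= 'Thm. 4')] [cite: Serre1972, §1.11 Prop. 12] -/
theorem bsdp_three_of_classX3_of_forall_ramified
    (hCGS : CastellaGrossiSkinner2025.thmD_padicValRat_bsd_rank_le_one)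
    (hGV : GreenbergVatsal2000.thm13_charIdeal_eq_of_gvPar) (hGr : greenberg_charValue_rankZero)
    (hmod : hasEntireLFunction_rat) (hmodP : nonempty_modularParametrizationData)
    (hGZK : rank_eq_analyticRank_of_analyticRank_le_one)
    (hMilneC : Milne1972.bsdQuotient_baseChange_quadratic_anyModel)
    (hHL : HoffsteinLuo1997_exists_twist_L_one_ne_zero)
    (hX : ClassX3 W 3) (hr : W.analyticRank ≤ 1)
    (hgood : ∀ (Wd : WeierstrassCurve ℚ) [Wd.IsElliptic] [Wd.IsGloballyMinimal],
      (∃ C : VariableChange ℚ, C • W.quadraticTwist ((-1 : ℚ) ^ ((3 : ℕ) / 2) * (3 : ℕ)) = Wd) →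
      Wd.HasGoodReductionAtPrime 3)
    (hK : ∀ (K : Type) [Field K] [NumberField K], Module.finrank ℚ K = 2 →
      (3 : ℤ) ∣ NumberField.discr K → MissingPPartOverCAt (W.baseChange K) 3) :
    BSDp W 3 := by
  -- the datum: a globally minimal model `W₁` of `E^{(−3)}`, good ORDINARY at `3`
  haveI := W.isElliptic_quadraticTwist (pStar_ne_zero 3)
  obtain ⟨C₁, hCmin⟩ :=
    hasGlobalMinimalModel_rat_holds (W.quadraticTwist ((-1 : ℚ) ^ ((3 : ℕ) / 2) * (3 : ℕ)))
  haveI := hCmin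
  set W₁ := C₁ • W.quadraticTwist ((-1 : ℚ) ^ ((3 : ℕ) / 2) * (3 : ℕ)) with hW₁_def
  have hC₁ : C₁ • W.quadraticTwist ((-1 : ℚ) ^ ((3 : ℕ) / 2) * (3 : ℕ)) = W₁ := rfl
  have hord₁ : GoodOrd W₁ 3 :=
    goodOrd_twist_of_red W 3 (by omega) hX.1 (pStar_ne_zero 3) W₁ ⟨C₁, hC₁⟩ (hgood W₁ ⟨C₁, hC₁⟩)
  -- supply
  obtain ⟨d', Wd, iWd, iWdm, hsq, hd8, hpd, ⟨C, hC⟩, hord, hr0, hna⟩ :=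
    exists_goodOrd_rankZero_nonAnom_twist_of_goodOrd_model W 3 hHL (by omega) W₁ ⟨C₁, hC₁⟩ hord₁
  obtain ⟨K, iF, iN, h2, hdK⟩ := exists_quadraticField_discr_pStar_mul 3 (by omega) hsq hd8 hpd
  have hdKQ : (NumberField.discr K : ℚ) = (-1 : ℚ) ^ ((3 : ℕ) / 2) * (3 : ℕ) * d' := by
    rw [hdK]; push_cast; ring
  have hpdK : (3 : ℤ) ∣ NumberField.discr K := by
    rw [hdK]; exact ⟨(-1 : ℤ) ^ ((3 : ℕ) / 2) * d', by push_cast; ring⟩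
  have hd0 : ((-1 : ℚ) ^ ((3 : ℕ) / 2) * (3 : ℕ) * d') ≠ 0 :=
    mul_ne_zero (pStar_ne_zero 3) (by exact_mod_cast hsq.ne_zero)
  have hrd : Wd.analyticRank ≤ 1 := by rw [hr0]; exact zero_le_one
  have hbsd : BSDp Wd 3 := RowC6.bsdp hCGS hGV hGr hmod hmodP hGZK hrd
    (rowC6_twist_of_classX3_of_not_dvd W 3 Wd (by norm_num) hX hd0 ⟨C, hC⟩ hord hna)
  have hWdK : ∃ C : VariableChange ℚ, C • W.quadraticTwist (NumberField.discr K : ℚ) = Wd := by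
    rw [hdKQ]; exact ⟨C, hC⟩
  exact bsdp_of_pPartOverC_baseChange W 3 K Wd hGZK hmod hMilneC hr h2 hWdK hrd (hK K h2 hpdK) hbsd

/-- **X4♯(G-ord) ∩ `I₀*` at `p = 3`, `ρ̄_{E,3}` onto, `r_an(E) ≤ 1`: `BSD(E,3)` from the over-`K`
input over the quadratic fields RAMIFIED at `3` — NO twist-rank datum.** Hypotheses as in gen 4's
`bsdp_three_of_classX4Gord_of_surj` (`ClassX4Gord W 3`, `Surj W 3`, the model-free twist-good datum
`hgood`), minus `hrd`; the over-`K` input is asked over every quadratic `K` with `3 ∣ d_K`. The twist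
`E^{(−3)}` is good ORDINARY (`goodOrd_of_typeGOrd_of_hasGoodReductionAtPrime`); the supplied
rank-0 twist `E^{(−3d')}`, `3 ∤ d'`, is good ordinary, irreducible with `ρ̄` onto (transport) —
row C16 (Yan–Zhu 2026 Thm. 4.15 / Wuthrich Lemma 20, `RowC16.bsdp`); descent over `ℚ(√(−3d'))`.
[cite: HoffsteinLuo1997, Theorem (§1, pp. 435–436)] [cite: YanZhu2026, Thm. 4.15] -/
theorem bsdp_three_of_classX4Gord_of_surj_of_forall_ramified
    (hYZ : YanZhu2026.thm415_padicValRat_bsd_rank_le_one)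
    (hW20 : Wuthrich2014.lemma20_surjective_threeAdic_of_semistable)
    (hmod : hasEntireLFunction_rat) (hGZK : rank_eq_analyticRank_of_analyticRank_le_one)
    (hMilneC : Milne1972.bsdQuotient_baseChange_quadratic_anyModel)
    (hHL : HoffsteinLuo1997_exists_twist_L_one_ne_zero)
    (hX : ClassX4Gord W 3) (hsurj : Surj W 3) (hr : W.analyticRank ≤ 1)
    (hgood : ∀ (Wd : WeierstrassCurve ℚ) [Wd.IsElliptic] [Wd.IsGloballyMinimal],
      (∃ C : VariableChange ℚ, C • W.quadraticTwist ((-1 : ℚ) ^ ((3 : ℕ) / 2) * (3 : ℕ)) = Wd) →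
      Wd.HasGoodReductionAtPrime 3)
    (hK : ∀ (K : Type) [Field K] [NumberField K], Module.finrank ℚ K = 2 →
      (3 : ℤ) ∣ NumberField.discr K → MissingPPartOverCAt (W.baseChange K) 3) :
    BSDp W 3 := by
  haveI := W.isElliptic_quadraticTwist (pStar_ne_zero 3)
  obtain ⟨C₁, hCmin⟩ :=
    hasGlobalMinimalModel_rat_holds (W.quadraticTwist ((-1 : ℚ) ^ ((3 : ℕ) / 2) * (3 : ℕ)))
  haveI := hCmin
  set W₁ := C₁ • W.quadraticTwist ((-1 : ℚ) ^ ((3 : ℕ) / 2) * (3 : ℕ)) with hW₁_def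
  have hC₁ : C₁ • W.quadraticTwist ((-1 : ℚ) ^ ((3 : ℕ) / 2) * (3 : ℕ)) = W₁ := rfl
  have hord₁ : GoodOrd W₁ 3 :=
    goodOrd_of_typeGOrd_of_hasGoodReductionAtPrime W 3 (by omega) hX.typeGOrd W₁ ⟨C₁, hC₁⟩
      (hgood W₁ ⟨C₁, hC₁⟩)
  obtain ⟨d', Wd, iWd, iWdm, hsq, hd8, hpd, ⟨C, hC⟩, hord, hr0, -⟩ :=
    exists_goodOrd_rankZero_nonAnom_twist_of_goodOrd_model W 3 hHL (by omega) W₁ ⟨C₁, hC₁⟩ hord₁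
  obtain ⟨K, iF, iN, h2, hdK⟩ := exists_quadraticField_discr_pStar_mul 3 (by omega) hsq hd8 hpd
  have hdKQ : (NumberField.discr K : ℚ) = (-1 : ℚ) ^ ((3 : ℕ) / 2) * (3 : ℕ) * d' := by
    rw [hdK]; push_cast; ring
  have hpdK : (3 : ℤ) ∣ NumberField.discr K := by
    rw [hdK]; exact ⟨(-1 : ℤ) ^ ((3 : ℕ) / 2) * d', by push_cast; ring⟩
  have hd0 : ((-1 : ℚ) ^ ((3 : ℕ) / 2) * (3 : ℕ) * d') ≠ 0 :=
    mul_ne_zero (pStar_ne_zero 3) (by exact_mod_cast hsq.ne_zero)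
  have hrd : Wd.analyticRank ≤ 1 := by rw [hr0]; exact zero_le_one
  have hrow : RowC16 Wd 3 :=
    ⟨rfl, hord, (irr_iff_of_model_twist hd0 ⟨C, hC⟩).mpr hX.classX4.2.2,
      Or.inl ((surj_iff_of_model_twist W 3 hd0 ⟨C, hC⟩).mpr hsurj)⟩
  have hbsd : BSDp Wd 3 := RowC16.bsdp hYZ hW20 hmod hGZK hrd hrow
  have hWdK : ∃ C : VariableChange ℚ, C • W.quadraticTwist (NumberField.discr K : ℚ) = Wd := by
    rw [hdKQ]; exact ⟨C, hC⟩
  exact bsdp_of_pPartOverC_baseChange W 3 K Wd hGZK hmod hMilneC hr h2 hWdK hrd (hK K h2 hpdK) hbsd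

end Three

end Summit.BirchSwinnertonDyer.Rank1Residual.Additive

end
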